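import Literature.NumberTheory.EllipticCurves.TwoIsogenyShaTwoTorsionEqPhi
import Literature.NumberTheory.EllipticCurves.TwoIsogenySelmerXCubeAddPXSha
import Literature.NumberTheory.EllipticCurves.XCubeSub8XSqAddXSha
import Literature.NumberTheory.EllipticCurves.Curve346NontrivialSha
import Literature.NumberTheory.EllipticCurves.Curve6137TwoIsogenyDescent
import HarnessLib

/-!
# `Ш(E/ℚ)[2] ≅ (ℤ/2ℤ)²` EXACTLY for three curves: `E₁₇ : y² = x³ + 17x` (Silverman, AEC, Prop. X.6.5(b) as printed),
# `X₈ : y² = x³ − 8x² + x` (rank 0) and `X₃₄₆ = [0, −346, 0, 1369, 0]` (rank 2)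

Topic `NumberTheory/EllipticCurves`. The tree has `#(Ш(E) ∩ im Ξ) = 4` («`Ш(E)[φ]` has order `4`») for `E₁₇ = [0,0,0,17,0]`
(`XCubeAddPX.natCard_sha_inf_range_eq_four`; «`Ш(E_p/ℚ)[φ] = Ш(E_p/ℚ)[2]` not formalized» there), `X₈ = [0,−8,0,1,0]` and
`X₃₄₆ = [0,−346,0,1369,0]` (isogeny-door carriers of route ShaPrimaryTransfer). By `TwoIsogenyShaTwoTorsionEqPhi`
(`Ш(E')[φ̂] = 0 ⇒ Ш(E)[2] = Ш(E) ∩ im Ξ`) the printed statement follows once the DUAL side is trivial — one more tiny Selmer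
bound each, for `E'' = (E')'`: `2^{dim₂ S(a'',b'')} = #α(E''(ℚ))·#(Ш(E') ∩ im Ξ)` (tree `two_pow_twoIsogenySelmerRank_eq_natCard_mul`):
§1 `E₁₇`: `S(0,272) ⊆ {1,17}`, `#α ≥ 2` ⇒ **`#Ш(E₁₇/ℚ)[2] = 4`** — AEC X.6.5(b) in full for `p = 17`; §2 `X₈`: `S(−32,16) ⊆ {1}`
⇒ **`#Ш(X₈/ℚ)[2] = 4`**; §3 `X₃₄₆`: `S(−1384,21904) ⊆ {1}` ⇒ **`#Ш(X₃₄₆/ℚ)[2] = 4`** (rank `2`). Theorems only; no named facts.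

## References

* [SilvermanAEC2009] J. H. Silverman, *AEC*, 2nd ed.: Prop. X.6.5(b) and Remark X.6.5.1 (`p = 17`), Thm. X.4.2(a),
  Example X.4.10, proof of Prop. X.6.2(c).
-/

noncomputable section

open scoped Classical

namespace Literature.NumberTheory.EllipticCurves

namespace ShaTwoTorsionExamples

open _root_.WeierstrassCurve _root_.WeierstrassCurve.Affine

/-- From `2^{dim} = #α · #(Ш ∩ im Ξ)` with `2^{dim} ≤ #α`: the `Ш`-factor is `1`. [cite: SilvermanAEC2009, Thm. X.4.2(a)] -/
private theorem natCard_eq_one_of_mul_eq {s A N : ℕ} (h : 2 ^ s = A * N) (hA : 2 ^ s ≤ A) : N = 1 := by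
  have hpos : 0 < 2 ^ s := pow_pos (by norm_num) s
  rcases Nat.eq_zero_or_pos N with h0 | hN
  · rw [h0, mul_zero] at h; omega
  · rcases Nat.lt_or_ge 1 N with h2 | h1 <;> nlinarith

/-! ## Dual-side Selmer bounds (the congruence method) -/

/-- `S(-32, 16)` does not contain: `d = -1, 2` modulo `3`; `d = -2` modulo `5` (no solution of either chart modulo the stated prime power).
[cite: SilvermanAEC2009, Example X.4.10 (the congruence method)] -/
theorem not_mem_S_X8dual :
    (-1 : ℤ) ∉ twoIsogenySelmerGroup (-32) (16) ∧
      (2 : ℤ) ∉ twoIsogenySelmerGroup (-32) (16) ∧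
      (-2 : ℤ) ∉ twoIsogenySelmerGroup (-32) (16) := by
  have hB : (16 : ℤ) ≠ 0 := by norm_num
  haveI : Fact (Nat.Prime 3) := ⟨by norm_num⟩
  haveI : Fact (Nat.Prime 5) := ⟨by norm_num⟩
  refine ⟨?_, ?_, ?_⟩
  · refine Carrier6137.not_mem_twoIsogenySelmerGroup_of_not_isSoluble hB 3 ?_
    rw [show (16 : ℤ) / -1 = -16 by norm_num]
    exact Carrier6137.not_isSoluble_padic_twoIsogenyQuartic_of_zmodPow 1 (by decide)
  · refine Carrier6137.not_mem_twoIsogenySelmerGroup_of_not_isSoluble hB 3 ?_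
    rw [show (16 : ℤ) / 2 = 8 by norm_num]
    exact Carrier6137.not_isSoluble_padic_twoIsogenyQuartic_of_zmodPow 1 (by decide)
  · refine Carrier6137.not_mem_twoIsogenySelmerGroup_of_not_isSoluble hB 5 ?_
    rw [show (16 : ℤ) / -2 = -8 by norm_num]
    exact Carrier6137.not_isSoluble_padic_twoIsogenyQuartic_of_zmodPow 1 (by decide)

/-- A squarefree integer dividing `16` is `±` a divisor of `2`. [cite: SilvermanAEC2009, Prop. X.4.9] -/
private theorem mem_of_dvd_16 {d : ℤ} (hsq : Squarefree d) (hd : d ∣ (16 : ℤ)) :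
    d ∈ ({1, -1, 2, -2} : Finset ℤ) := by
  have hrad : d ∣ 2 := by
    have h5 : d ∣ (2 : ℤ) ^ 4 := dvd_trans hd ⟨1, by norm_num⟩
    exact (hsq.dvd_pow_iff_dvd (by norm_num)).mp h5
  have h1 : d.natAbs ∣ 2 := by
    have := Int.natAbs_dvd_natAbs.mpr hrad
    simpa using this
  have h2 : d.natAbs ∈ Nat.divisors 2 := Nat.mem_divisors.mpr ⟨h1, by norm_num⟩
  rw [show Nat.divisors 2 = {1, 2} by decide] at h2
  simp only [Finset.mem_insert, Finset.mem_singleton] at h2 ⊢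
  rcases Int.natAbs_eq d with h | h <;> rw [h] <;> rcases h2 with h2 | h2 <;> simp [h2]

/-- **`S(-32, 16) ⊆ {1}`** (only the class of `O`). [cite: SilvermanAEC2009, Prop. X.4.9 and Example X.4.10] -/
theorem subset_S_X8dual :
    twoIsogenySelmerGroup (-32) (16) ⊆ ({1} : Finset ℤ) := by
  intro d hd
  obtain ⟨hsq, hdvd, -⟩ := (mem_twoIsogenySelmerGroup_iff (a := -32) (by norm_num : (16 : ℤ) ≠ 0)).mp hd
  have hmem := mem_of_dvd_16 hsq hdvd
  obtain ⟨hm1, h2, hm2⟩ := not_mem_S_X8dual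
  simp only [Finset.mem_insert, Finset.mem_singleton] at hmem ⊢
  rcases hmem with rfl | rfl | rfl | rfl
  · simp
  · exact absurd hd hm1
  · exact absurd hd h2
  · exact absurd hd hm2

/-- `S(0, 272)` does not contain: `d = 2, -2, 34, -34` modulo `16`; `d = -1, -17` modulo `64` (no solution of either chart modulo the stated prime power).
[cite: SilvermanAEC2009, Example X.4.10 (the congruence method)] -/
theorem not_mem_S_E17dual :
    (-1 : ℤ) ∉ twoIsogenySelmerGroup (0) (272) ∧
      (2 : ℤ) ∉ twoIsogenySelmerGroup (0) (272) ∧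
      (-2 : ℤ) ∉ twoIsogenySelmerGroup (0) (272) ∧
      (-17 : ℤ) ∉ twoIsogenySelmerGroup (0) (272) ∧
      (34 : ℤ) ∉ twoIsogenySelmerGroup (0) (272) ∧
      (-34 : ℤ) ∉ twoIsogenySelmerGroup (0) (272) := by
  have hB : (272 : ℤ) ≠ 0 := by norm_num
  haveI : Fact (Nat.Prime 2) := ⟨by norm_num⟩
  refine ⟨?_, ?_, ?_, ?_, ?_, ?_⟩
  · refine Carrier6137.not_mem_twoIsogenySelmerGroup_of_not_isSoluble hB 2 ?_
    rw [show (272 : ℤ) / -1 = -272 by norm_num]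
    exact Carrier6137.not_isSoluble_padic_twoIsogenyQuartic_of_zmodPow 6 (by decide +kernel)
  · refine Carrier6137.not_mem_twoIsogenySelmerGroup_of_not_isSoluble hB 2 ?_
    rw [show (272 : ℤ) / 2 = 136 by norm_num]
    exact Carrier6137.not_isSoluble_padic_twoIsogenyQuartic_of_zmodPow 4 (by decide)
  · refine Carrier6137.not_mem_twoIsogenySelmerGroup_of_not_isSoluble hB 2 ?_
    rw [show (272 : ℤ) / -2 = -136 by norm_num]
    exact Carrier6137.not_isSoluble_padic_twoIsogenyQuartic_of_zmodPow 4 (by decide)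
  · refine Carrier6137.not_mem_twoIsogenySelmerGroup_of_not_isSoluble hB 2 ?_
    rw [show (272 : ℤ) / -17 = -16 by norm_num]
    exact Carrier6137.not_isSoluble_padic_twoIsogenyQuartic_of_zmodPow 6 (by decide +kernel)
  · refine Carrier6137.not_mem_twoIsogenySelmerGroup_of_not_isSoluble hB 2 ?_
    rw [show (272 : ℤ) / 34 = 8 by norm_num]
    exact Carrier6137.not_isSoluble_padic_twoIsogenyQuartic_of_zmodPow 4 (by decide)
  · refine Carrier6137.not_mem_twoIsogenySelmerGroup_of_not_isSoluble hB 2 ?_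
    rw [show (272 : ℤ) / -34 = -8 by norm_num]
    exact Carrier6137.not_isSoluble_padic_twoIsogenyQuartic_of_zmodPow 4 (by decide)

/-- A squarefree integer dividing `272` is `±` a divisor of `34`. [cite: SilvermanAEC2009, Prop. X.4.9] -/
private theorem mem_of_dvd_272 {d : ℤ} (hsq : Squarefree d) (hd : d ∣ (272 : ℤ)) :
    d ∈ ({1, -1, 2, -2, 17, -17, 34, -34} : Finset ℤ) := by
  have hrad : d ∣ 34 := by
    have h5 : d ∣ (34 : ℤ) ^ 4 := dvd_trans hd ⟨4913, by norm_num⟩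
    exact (hsq.dvd_pow_iff_dvd (by norm_num)).mp h5
  have h1 : d.natAbs ∣ 34 := by
    have := Int.natAbs_dvd_natAbs.mpr hrad
    simpa using this
  have h2 : d.natAbs ∈ Nat.divisors 34 := Nat.mem_divisors.mpr ⟨h1, by norm_num⟩
  rw [show Nat.divisors 34 = {1, 2, 17, 34} by decide] at h2
  simp only [Finset.mem_insert, Finset.mem_singleton] at h2 ⊢
  rcases Int.natAbs_eq d with h | h <;> rw [h] <;> rcases h2 with h2 | h2 | h2 | h2 <;> simp [h2]

/-- **`S(0, 272) ⊆ {1, 17}`** (the classes of `O` and `T` (`[272] = [17]`)). [cite: SilvermanAEC2009, Prop. X.4.9 and Example X.4.10] -/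
theorem subset_S_E17dual :
    twoIsogenySelmerGroup (0) (272) ⊆ ({1, 17} : Finset ℤ) := by
  intro d hd
  obtain ⟨hsq, hdvd, -⟩ := (mem_twoIsogenySelmerGroup_iff (a := 0) (by norm_num : (272 : ℤ) ≠ 0)).mp hd
  have hmem := mem_of_dvd_272 hsq hdvd
  obtain ⟨hm1, h2, hm2, hm17, h34, hm34⟩ := not_mem_S_E17dual
  simp only [Finset.mem_insert, Finset.mem_singleton] at hmem ⊢
  rcases hmem with rfl | rfl | rfl | rfl | rfl | rfl | rfl | rfl
  · simp
  · exact absurd hd hm1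
  · exact absurd hd h2
  · exact absurd hd hm2
  · simp
  · exact absurd hd hm17
  · exact absurd hd h34
  · exact absurd hd hm34

/-- `S(-1384, 21904)` does not contain: `d = -1, 2, -37, 74` modulo `9`; `d = -2, -74` modulo `16`; `d = 37` modulo `25` (no solution of either chart modulo the stated prime power).
[cite: SilvermanAEC2009, Example X.4.10 (the congruence method)] -/
theorem not_mem_S_X346dual :
    (-1 : ℤ) ∉ twoIsogenySelmerGroup (-1384) (21904) ∧
      (2 : ℤ) ∉ twoIsogenySelmerGroup (-1384) (21904) ∧
      (-2 : ℤ) ∉ twoIsogenySelmerGroup (-1384) (21904) ∧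
      (37 : ℤ) ∉ twoIsogenySelmerGroup (-1384) (21904) ∧
      (-37 : ℤ) ∉ twoIsogenySelmerGroup (-1384) (21904) ∧
      (74 : ℤ) ∉ twoIsogenySelmerGroup (-1384) (21904) ∧
      (-74 : ℤ) ∉ twoIsogenySelmerGroup (-1384) (21904) := by
  have hB : (21904 : ℤ) ≠ 0 := by norm_num
  haveI : Fact (Nat.Prime 2) := ⟨by norm_num⟩
  haveI : Fact (Nat.Prime 3) := ⟨by norm_num⟩
  haveI : Fact (Nat.Prime 5) := ⟨by norm_num⟩
  refine ⟨?_, ?_, ?_, ?_, ?_, ?_, ?_⟩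
  · refine Carrier6137.not_mem_twoIsogenySelmerGroup_of_not_isSoluble hB 3 ?_
    rw [show (21904 : ℤ) / -1 = -21904 by norm_num]
    exact Carrier6137.not_isSoluble_padic_twoIsogenyQuartic_of_zmodPow 2 (by decide)
  · refine Carrier6137.not_mem_twoIsogenySelmerGroup_of_not_isSoluble hB 3 ?_
    rw [show (21904 : ℤ) / 2 = 10952 by norm_num]
    exact Carrier6137.not_isSoluble_padic_twoIsogenyQuartic_of_zmodPow 2 (by decide)
  · refine Carrier6137.not_mem_twoIsogenySelmerGroup_of_not_isSoluble hB 2 ?_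
    rw [show (21904 : ℤ) / -2 = -10952 by norm_num]
    exact Carrier6137.not_isSoluble_padic_twoIsogenyQuartic_of_zmodPow 4 (by decide)
  · refine Carrier6137.not_mem_twoIsogenySelmerGroup_of_not_isSoluble hB 5 ?_
    rw [show (21904 : ℤ) / 37 = 592 by norm_num]
    exact Carrier6137.not_isSoluble_padic_twoIsogenyQuartic_of_zmodPow 2 (by decide)
  · refine Carrier6137.not_mem_twoIsogenySelmerGroup_of_not_isSoluble hB 3 ?_
    rw [show (21904 : ℤ) / -37 = -592 by norm_num]
    exact Carrier6137.not_isSoluble_padic_twoIsogenyQuartic_of_zmodPow 2 (by decide)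
  · refine Carrier6137.not_mem_twoIsogenySelmerGroup_of_not_isSoluble hB 3 ?_
    rw [show (21904 : ℤ) / 74 = 296 by norm_num]
    exact Carrier6137.not_isSoluble_padic_twoIsogenyQuartic_of_zmodPow 2 (by decide)
  · refine Carrier6137.not_mem_twoIsogenySelmerGroup_of_not_isSoluble hB 2 ?_
    rw [show (21904 : ℤ) / -74 = -296 by norm_num]
    exact Carrier6137.not_isSoluble_padic_twoIsogenyQuartic_of_zmodPow 4 (by decide)

/-- A squarefree integer dividing `21904` is `±` a divisor of `74`. [cite: SilvermanAEC2009, Prop. X.4.9] -/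
private theorem mem_of_dvd_21904 {d : ℤ} (hsq : Squarefree d) (hd : d ∣ (21904 : ℤ)) :
    d ∈ ({1, -1, 2, -2, 37, -37, 74, -74} : Finset ℤ) := by
  have hrad : d ∣ 74 := by
    have h5 : d ∣ (74 : ℤ) ^ 4 := dvd_trans hd ⟨1369, by norm_num⟩
    exact (hsq.dvd_pow_iff_dvd (by norm_num)).mp h5
  have h1 : d.natAbs ∣ 74 := by
    have := Int.natAbs_dvd_natAbs.mpr hrad
    simpa using this
  have h2 : d.natAbs ∈ Nat.divisors 74 := Nat.mem_divisors.mpr ⟨h1, by norm_num⟩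
  rw [show Nat.divisors 74 = {1, 2, 37, 74} by decide] at h2
  simp only [Finset.mem_insert, Finset.mem_singleton] at h2 ⊢
  rcases Int.natAbs_eq d with h | h <;> rw [h] <;> rcases h2 with h2 | h2 | h2 | h2 <;> simp [h2]

/-- **`S(-1384, 21904) ⊆ {1}`** (only the class of `O`). [cite: SilvermanAEC2009, Prop. X.4.9 and Example X.4.10] -/
theorem subset_S_X346dual :
    twoIsogenySelmerGroup (-1384) (21904) ⊆ ({1} : Finset ℤ) := by
  intro d hd
  obtain ⟨hsq, hdvd, -⟩ := (mem_twoIsogenySelmerGroup_iff (a := -1384) (by norm_num : (21904 : ℤ) ≠ 0)).mp hd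
  have hmem := mem_of_dvd_21904 hsq hdvd
  obtain ⟨hm1, h2, hm2, h37, hm37, h74, hm74⟩ := not_mem_S_X346dual
  simp only [Finset.mem_insert, Finset.mem_singleton] at hmem ⊢
  rcases hmem with rfl | rfl | rfl | rfl | rfl | rfl | rfl | rfl
  · simp
  · exact absurd hd hm1
  · exact absurd hd h2
  · exact absurd hd hm2
  · exact absurd hd h37
  · exact absurd hd hm37
  · exact absurd hd h74
  · exact absurd hd hm74

/-- Squarefree integers with the same square class in `ℚ*/ℚ*²` are equal. [cite: SilvermanTate2015, §3.5] -/
private theorem eq_of_sqClass_intCast_eq {d₁ d₂ : ℤ} (h₁ : Squarefree d₁) (h₂ : Squarefree d₂)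
    (he : sqClass (d₁ : ℚ) = sqClass (d₂ : ℚ)) : d₁ = d₂ := by
  have h0₁ : (d₁ : ℚ) ≠ 0 := by exact_mod_cast h₁.ne_zero
  have h0₂ : (d₂ : ℚ) ≠ 0 := by exact_mod_cast h₂.ne_zero
  have h1 : sqClass ((d₁ : ℚ) * d₂) = 1 := by rw [sqClass_mul h0₁ h0₂, he, SqUnits.mul_self]
  obtain ⟨u, hu⟩ := (sqClass_eq_one_iff (mul_ne_zero h0₁ h0₂)).mp h1
  obtain ⟨m, hm⟩ : IsSquare (d₁ * d₂) := by
    rw [← Rat.isSquare_intCast_iff]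
    exact ⟨u, by push_cast; rw [hu, pow_two]⟩
  exact eq_of_squarefree_of_mul_eq_sq h₁ h₂ (m := m) (by rw [hm, pow_two])

/-- Squarefreeness of a (small) integer from the factorisation of its absolute value. [cite: SilvermanTate2015, §3.5] -/
private theorem squarefree_int_of_natAbs {d : ℤ} {n : ℕ} (h : d.natAbs = n) (hn : n ≠ 0)
    (hnd : n.primeFactorsList.Nodup) : Squarefree d :=
  Int.squarefree_natAbs.mp (h ▸ (Nat.squarefree_iff_nodup_primeFactorsList hn).mpr hnd)

/-- `[x t²] = [x]` in `ℚ*/ℚ*²`. [cite: SilvermanTate2015, §3.5] -/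
private theorem sqClass_mul_sq' {x t : ℚ} (hx : x ≠ 0) (ht : t ≠ 0) :
    sqClass (x * t ^ 2) = sqClass x := by
  rw [sqClass_mul hx (pow_ne_zero 2 ht), sqClass_sq, mul_one]

/-- `b(a² − 4b) ≠ 0` for `(a,b) = (0,272)`. [cite: SilvermanAEC2009, Prop. X.4.9] -/
private theorem hab272 : (272 : ℤ) * ((0 : ℤ) ^ 2 - 4 * 272) ≠ 0 := by norm_num

/-- `[0,0,0,272,0]` is an elliptic curve. [cite: SilvermanAEC2009, Prop. X.4.9] -/
private theorem isElliptic_272 : (⟨0, 0, 0, 272, 0⟩ : WeierstrassCurve ℚ).IsElliptic := by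
  have h := isElliptic_mk_of_ne_zero (F := ℚ) hab272
  have e : (⟨0, ((0 : ℤ) : ℚ), 0, ((272 : ℤ) : ℚ), 0⟩ : WeierstrassCurve ℚ) = ⟨0, 0, 0, 272, 0⟩ := by
    ext <;> push_cast <;> ring
  rwa [e] at h

/-- **`#α ≥ 2`** on `[0, 0, 0, 272, 0]`: `[1]` and `α(T) = [272] = [17]`. [cite: SilvermanTate2015, §3.5–§3.6] -/
theorem two_le_natCard_range_xSqClass_272 :
    (Set.range (⟨0, 0, 0, 272, 0⟩ : WeierstrassCurve ℚ).xSqClass).Finite ∧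
      2 ≤ Nat.card (Set.range (⟨0, 0, 0, 272, 0⟩ : WeierstrassCurve ℚ).xSqClass) := by
  haveI := isElliptic_272
  set W := (⟨0, 0, 0, 272, 0⟩ : WeierstrassCurve ℚ) with hW
  have hfin : (Set.range W.xSqClass).Finite := by
    have h := (natCard_range_xSqClass_le (a := 0) (b := 272) hab272).1
    have e : (⟨0, ((0 : ℤ) : ℚ), 0, ((272 : ℤ) : ℚ), 0⟩ : WeierstrassCurve ℚ) = W := by
      rw [hW]; ext <;> push_cast <;> ring
    rw [e] at h
    exact h
  refine ⟨hfin, ?_⟩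
  have hs1 : sqClass (((1 : ℤ)) : ℚ) ∈ Set.range W.xSqClass := by
    refine ⟨0, ?_⟩
    rw [xSqClass_zero, Int.cast_one]
    exact ((sqClass_eq_one_iff one_ne_zero).mpr ⟨1, by norm_num⟩).symm
  have hs17 : sqClass (((17 : ℤ)) : ℚ) ∈ Set.range W.xSqClass := by
    refine ⟨W.twoTorsionPoint, ?_⟩
    rw [xSqClass_twoTorsionPoint]
    show sqClass (272 : ℚ) = _
    rw [show (272 : ℚ) = 17 * 4 ^ 2 by norm_num, sqClass_mul_sq' (by norm_num) (by norm_num)]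
    push_cast
    rfl
  have hsqf : ∀ d ∈ ({1, 17} : Finset ℤ), Squarefree d := by
    intro d hd
    simp only [Finset.mem_insert, Finset.mem_singleton] at hd
    rcases hd with rfl | rfl
    · exact squarefree_int_of_natAbs (n := 1) rfl one_ne_zero (by simp)
    · exact squarefree_int_of_natAbs (n := 17) rfl (by norm_num) (by simp)
  have hsub : (↑(({1, 17} : Finset ℤ).image fun d : ℤ => sqClass (d : ℚ)) :
      Set (SqUnits ℚ)) ⊆ Set.range W.xSqClass := by
    intro c hc
    obtain ⟨d, hd, rfl⟩ := Finset.mem_image.mp (Finset.mem_coe.mp hc)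
    simp only [Finset.mem_insert, Finset.mem_singleton] at hd
    rcases hd with rfl | rfl
    · exact hs1
    · exact hs17
  have hcard : (({1, 17} : Finset ℤ).image fun d : ℤ => sqClass (d : ℚ)).card = 2 := by
    rw [Finset.card_image_of_injOn (fun d₁ h₁ d₂ h₂ he =>
      eq_of_sqClass_intCast_eq (hsqf d₁ h₁) (hsqf d₂ h₂) he)]
    rfl
  calc 2 = (↑(({1, 17} : Finset ℤ).image fun d : ℤ => sqClass (d : ℚ)) :
        Set (SqUnits ℚ)).ncard := by rw [Set.ncard_coe_finset, hcard]
    _ ≤ (Set.range W.xSqClass).ncard := Set.ncard_le_ncard hsub hfin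
    _ = Nat.card (Set.range W.xSqClass) := (Nat.card_coe_set_eq _).symm

/-! ## §1 `E₁₇ : y² = x³ + 17x` — AEC Prop. X.6.5(b) as printed: `Ш(E₁₇/ℚ)[2] ≅ (ℤ/2ℤ)²` -/

/-- `Ш(E'₁₇) ∩ im Ξ_{E'₁₇} = ⊥` for `E'₁₇ = E₁₇.twoIsogenyCodomain = [0,0,0,−68,0]`: `2^{dim₂ S(0,272)} = #α(E''(ℚ))·#(Ш(E') ∩ im Ξ)`
with `S(0,272) ⊆ {1,17}` and `[1], [272] = [17] ∈ α(E''(ℚ))`. [cite: SilvermanAEC2009, Prop. X.6.2(b) (S^{(φ̂)}(E'_p/ℚ) = {1, p})] -/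
theorem sha_inf_range_dual_seventeen_eq_bot [(⟨0, 0, 0, 17, 0⟩ : WeierstrassCurve ℚ).IsElliptic] :
    (⟨0, 0, 0, 17, 0⟩ : WeierstrassCurve ℚ).twoIsogenyCodomain.sha ⊓
      (⟨0, 0, 0, 17, 0⟩ : WeierstrassCurve ℚ).twoIsogenyCodomain.twoIsogenyTorsorHom.range = ⊥ := by
  have hV : (⟨0, 0, 0, 17, 0⟩ : WeierstrassCurve ℚ).twoIsogenyCodomain.twoIsogenyCodomain =
      ⟨0, ((0 : ℤ) : ℚ), 0, ((272 : ℤ) : ℚ), 0⟩ := by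
    ext <;> norm_num [twoIsogenyCodomain]
  have hab : (272 : ℤ) * ((0 : ℤ) ^ 2 - 4 * 272) ≠ 0 := by norm_num
  have key := two_pow_twoIsogenySelmerRank_eq_natCard_mul hab _ hV
  -- `2^{dim} ≤ 2`
  have hs : 2 ^ twoIsogenySelmerRank 0 272 ≤ 2 := by
    rw [two_pow_twoIsogenySelmerRank_eq_card hab]
    exact (Finset.card_le_card subset_S_E17dual).trans (by decide)
  -- `#α(E''(ℚ)) ≥ 2`: `[1]` and `[272] = [17]`
  have hα := two_le_natCard_range_xSqClass_272.2
  have hlit : (⟨0, 0, 0, 272, 0⟩ : WeierstrassCurve ℚ) = ⟨0, ((0 : ℤ) : ℚ), 0, ((272 : ℤ) : ℚ), 0⟩ := by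
    ext <;> push_cast <;> ring
  rw [hlit] at hα
  exact sha_inf_range_eq_bot_of_natCard_eq_one _ (natCard_eq_one_of_mul_eq key (hs.trans hα))

/-- **Silverman, AEC, Prop. X.6.5(b) for `p = 17`, as printed: `Ш(E₁₇/ℚ)[2] ≅ (ℤ/2ℤ)²`** — the `2`-torsion subgroup of
`Ш(E₁₇/ℚ)`, `E₁₇ : y² = x³ + 17x`, has exactly `4` elements (and is killed by `2`): `Ш(E₁₇)[2] = Ш(E₁₇)[φ]` (dual side trivial)
and `#Ш(E₁₇)[φ] = 4` (tree `XCubeAddPX.natCard_sha_inf_range_eq_four`). [cite: SilvermanAEC2009, Prop. X.6.5(b) and Remark X.6.5.1] -/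
theorem natCard_sha_inf_torsionBy_two_seventeen [(⟨0, 0, 0, 17, 0⟩ : WeierstrassCurve ℚ).IsElliptic] :
    Nat.card ↥((⟨0, 0, 0, 17, 0⟩ : WeierstrassCurve ℚ).sha ⊓
      AddSubgroup.torsionBy (⟨0, 0, 0, 17, 0⟩ : WeierstrassCurve ℚ).galH1 2) = 4 := by
  haveI : Fact (Nat.Prime 17) := ⟨by norm_num⟩
  rw [sha_inf_torsionBy_two_eq_sha_inf_range _ sha_inf_range_dual_seventeen_eq_bot]
  exact XCubeAddPX.natCard_sha_inf_range_eq_four (p := 17) (by norm_num) Literature.NumberTheory.DiophantineGeometry.LindReichardt.pow_four_ne_two_17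

/-! ## §2 `X₈ : y² = x³ − 8x² + x` (rank `0`, `t_2 = 0`): `Ш(X₈/ℚ)[2] ≅ (ℤ/2ℤ)²` -/

/-- `Ш(X'₈) ∩ im Ξ = ⊥` for `X'₈ = [0,16,0,60,0]`: `2^{dim₂ S(−32,16)} = #α·#(Ш(X'₈) ∩ im Ξ)` with `S(−32,16) ⊆ {1}`.
[cite: SilvermanAEC2009, Thm. X.4.2(a) with Example X.4.10] -/
theorem sha_inf_range_dual_X8_eq_bot [(⟨0, -8, 0, 1, 0⟩ : WeierstrassCurve ℚ).IsElliptic] :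
    (⟨0, -8, 0, 1, 0⟩ : WeierstrassCurve ℚ).twoIsogenyCodomain.sha ⊓
      (⟨0, -8, 0, 1, 0⟩ : WeierstrassCurve ℚ).twoIsogenyCodomain.twoIsogenyTorsorHom.range = ⊥ := by
  have hV : (⟨0, -8, 0, 1, 0⟩ : WeierstrassCurve ℚ).twoIsogenyCodomain.twoIsogenyCodomain =
      ⟨0, ((-32 : ℤ) : ℚ), 0, ((16 : ℤ) : ℚ), 0⟩ := by
    ext <;> norm_num [twoIsogenyCodomain]
  have hab : (16 : ℤ) * ((-32 : ℤ) ^ 2 - 4 * 16) ≠ 0 := by norm_num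
  have key := two_pow_twoIsogenySelmerRank_eq_natCard_mul hab _ hV
  have hs : 2 ^ twoIsogenySelmerRank (-32) 16 ≤ 1 := by
    rw [two_pow_twoIsogenySelmerRank_eq_card hab]
    exact (Finset.card_le_card subset_S_X8dual).trans (by decide)
  haveI hE'' : (⟨0, ((-32 : ℤ) : ℚ), 0, ((16 : ℤ) : ℚ), 0⟩ : WeierstrassCurve ℚ).IsElliptic := isElliptic_mk_of_ne_zero hab
  have hα : 1 ≤ Nat.card (Set.range (⟨0, ((-32 : ℤ) : ℚ), 0, ((16 : ℤ) : ℚ), 0⟩ : WeierstrassCurve ℚ).xSqClass) := by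
    haveI := (natCard_range_xSqClass_le (a := -32) (b := 16) hab).1.to_subtype
    exact Nat.card_pos
  exact sha_inf_range_eq_bot_of_natCard_eq_one _ (natCard_eq_one_of_mul_eq key (hs.trans hα))

/-- **`Ш(X₈/ℚ)[2] ≅ (ℤ/2ℤ)²`** for `X₈ : y² = x³ − 8x² + x` (rank `0`, `t_2(X₈) = 0`, tree `XCubeSub8XSqAddX*`): the `2`-torsion
subgroup of `Ш(X₈/ℚ)` has exactly `4` elements. [cite: SilvermanAEC2009, Prop. X.6.5(b) (the method)] -/
theorem natCard_sha_inf_torsionBy_two_X8 [(⟨0, -8, 0, 1, 0⟩ : WeierstrassCurve ℚ).IsElliptic] :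
    Nat.card ↥((⟨0, -8, 0, 1, 0⟩ : WeierstrassCurve ℚ).sha ⊓
      AddSubgroup.torsionBy (⟨0, -8, 0, 1, 0⟩ : WeierstrassCurve ℚ).galH1 2) = 4 := by
  rw [sha_inf_torsionBy_two_eq_sha_inf_range _ sha_inf_range_dual_X8_eq_bot]
  exact XCubeSub8XSqAddX.natCard_sha_inf_range_eq_four

/-! ## §3 `X₃₄₆ = [0, −346, 0, 1369, 0]` (rank `2`, `t_2 = 0`): `Ш(X₃₄₆/ℚ)[2] ≅ (ℤ/2ℤ)²` -/

/-- `Ш(X'₃₄₆) ∩ im Ξ = ⊥` for `X'₃₄₆ = [0,692,0,114240,0]`: `S(−1384, 21904) ⊆ {1}`. [cite: SilvermanAEC2009, Thm. X.4.2(a) with Example X.4.10] -/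
theorem sha_inf_range_dual_X346_eq_bot [(⟨0, -346, 0, 1369, 0⟩ : WeierstrassCurve ℚ).IsElliptic] :
    (⟨0, -346, 0, 1369, 0⟩ : WeierstrassCurve ℚ).twoIsogenyCodomain.sha ⊓
      (⟨0, -346, 0, 1369, 0⟩ : WeierstrassCurve ℚ).twoIsogenyCodomain.twoIsogenyTorsorHom.range = ⊥ := by
  have hV : (⟨0, -346, 0, 1369, 0⟩ : WeierstrassCurve ℚ).twoIsogenyCodomain.twoIsogenyCodomain =
      ⟨0, ((-1384 : ℤ) : ℚ), 0, ((21904 : ℤ) : ℚ), 0⟩ := by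
    ext <;> norm_num [twoIsogenyCodomain]
  have hab : (21904 : ℤ) * ((-1384 : ℤ) ^ 2 - 4 * 21904) ≠ 0 := by norm_num
  have key := two_pow_twoIsogenySelmerRank_eq_natCard_mul hab _ hV
  have hs : 2 ^ twoIsogenySelmerRank (-1384) 21904 ≤ 1 := by
    rw [two_pow_twoIsogenySelmerRank_eq_card hab]
    exact (Finset.card_le_card subset_S_X346dual).trans (by decide)
  haveI hE'' : (⟨0, ((-1384 : ℤ) : ℚ), 0, ((21904 : ℤ) : ℚ), 0⟩ : WeierstrassCurve ℚ).IsElliptic :=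
    isElliptic_mk_of_ne_zero hab
  have hα : 1 ≤ Nat.card (Set.range (⟨0, ((-1384 : ℤ) : ℚ), 0, ((21904 : ℤ) : ℚ), 0⟩ : WeierstrassCurve ℚ).xSqClass) := by
    haveI := (natCard_range_xSqClass_le (a := -1384) (b := 21904) hab).1.to_subtype
    exact Nat.card_pos
  exact sha_inf_range_eq_bot_of_natCard_eq_one _ (natCard_eq_one_of_mul_eq key (hs.trans hα))

/-- **`Ш(X₃₄₆/ℚ)[2] ≅ (ℤ/2ℤ)²` at rank `2`** for `X₃₄₆ = [0, −346, 0, 1369, 0]` (`rank = 2`, `t_2 = 0`, tree `Curve346*`): the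
`2`-torsion subgroup of `Ш(X₃₄₆/ℚ)` has exactly `4` elements. [cite: SilvermanAEC2009, Prop. X.6.5(b) (the method)] -/
theorem natCard_sha_inf_torsionBy_two_X346 [(⟨0, -346, 0, 1369, 0⟩ : WeierstrassCurve ℚ).IsElliptic] :
    Nat.card ↥((⟨0, -346, 0, 1369, 0⟩ : WeierstrassCurve ℚ).sha ⊓
      AddSubgroup.torsionBy (⟨0, -346, 0, 1369, 0⟩ : WeierstrassCurve ℚ).galH1 2) = 4 := by
  rw [sha_inf_torsionBy_two_eq_sha_inf_range _ sha_inf_range_dual_X346_eq_bot]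
  exact Curve346.natCard_sha_inf_range_eq

end ShaTwoTorsionExamples

end Literature.NumberTheory.EllipticCurves

end
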